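import Mathlib.Geometry.Manifold.Algebra.LieGroup
import Mathlib.Geometry.Manifold.ContMDiff.Atlas
import Mathlib.Geometry.Manifold.ContMDiff.NormedSpace
import Literature.Analysis.Calculus.CommutativeLocalGroupLog
import HarnessLib

/-!
# The local exponential chart of a commutative complex Lie group

Topic `Geometry/Kaehler` (complex manifolds; the complex tori `ComplexTorus Φ` of this directory
are the target application); namespace `Literature.Geometry.Kaehler`. Theorems only.

Let `G` be a commutative complex Lie group: `[AddCommGroup G] [ChartedSpace E G]
[LieAddGroup 𝓘(ℂ, E) ω G]` with `E` a finite-dimensional complex normed space (the model, which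
plays the role of the Lie algebra `T₀ G` — all tangent spaces of an `E`-modelled manifold being
identified with `E` in Mathlib).

* `isCommHolomorphicLocalGroupLaw_chartAt` — the group law read in the preferred chart `ψ` at
  `0`, `(a, b) ↦ ψ (ψ⁻¹ a + ψ⁻¹ b)`, is a commutative holomorphic local group law at `ψ 0`
  (`Literature.Analysis.Calculus.IsCommHolomorphicLocalGroupLaw`: analytic, unital, associative
  and commutative near the base point).
* `exists_localExpChart` — **the local exponential chart**: a partial homeomorphism
  `f : E ⇀ G` defined on a ball about `0`, holomorphic with holomorphic inverse, `f 0 = 0`, and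
  ADDITIVE on the ball: `f (a + b) = f a + f b` for `‖a‖, ‖b‖ < ρ`. It is `ψ⁻¹ ∘ L⁻¹` for the
  local logarithm `L` of the chart law (`IsCommHolomorphicLocalGroupLaw.exists_localLog`,
  canonical coordinates), `L⁻¹` by the inverse function theorem.

The exponential map `exp : E →+ G` itself (`exp v = n • f (v / n)`) is in
`Literature/Geometry/Kaehler/ComplexLieGroupExp.lean`; the torus theorem in
`Literature/Geometry/Kaehler/CompactComplexLieGroupTorus.lean`. No Lie algebra, one-parameter
subgroup or ODE is used. Sources: Mumford, *Abelian Varieties*, §1 (the exponential map of a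
compact complex Lie group); Lange, *Abelian Varieties over the Complex Numbers*, Lemma 1.1.3 (c)
("`π : V = T₀X → X` is just the exponential map"); Chevalley, *Theory of Lie Groups*, Ch. IV
§VIII (canonical coordinates).

## References

* D. Mumford, *Abelian Varieties* (1970), §1. [MumfordAV1970]
* H. Lange, *Abelian Varieties over the Complex Numbers* (2023), Lemma 1.1.2, Lemma 1.1.3.
  [Lange2023AbelianVarietiesComplex]
* C. Chevalley, *Theory of Lie Groups* (1946), Ch. IV §VIII. [Chevalley1946]
* N. Bourbaki, *Groupes et algèbres de Lie*, Ch. III §1 no. 10. [Bourbaki2006LieGroups23]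
-/

noncomputable section

open Set Filter Function Metric
open scoped Topology ContDiff Manifold

namespace Literature.Geometry.Kaehler

open Literature.Analysis.Calculus

variable {E : Type*} [NormedAddCommGroup E] [NormedSpace ℂ E]
variable {G : Type*} [AddCommGroup G] [TopologicalSpace G] [ChartedSpace E G]
  [LieAddGroup 𝓘(ℂ, E) ω G]

/-! ### The group law in the chart at the identity -/

/-- The group law of `G` read in the preferred chart `ψ` at `0`, `(a, b) ↦ ψ (ψ⁻¹ a + ψ⁻¹ b)`, is
analytic at every `(a, b)` with `a, b ∈ ψ.target` and `ψ⁻¹ a + ψ⁻¹ b ∈ ψ.source`. [folklore] -/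
private theorem contDiffAt_chartLaw (p : E × E) (h1 : p.1 ∈ (chartAt E (0 : G)).target)
    (h2 : p.2 ∈ (chartAt E (0 : G)).target)
    (h12 : (chartAt E (0 : G)).symm p.1 + (chartAt E (0 : G)).symm p.2 ∈
      (chartAt E (0 : G)).source) :
    ContDiffAt ℂ ω (uncurry fun a b : E ↦ chartAt E (0 : G)
      ((chartAt E (0 : G)).symm a + (chartAt E (0 : G)).symm b)) p := by
  have hs1 : ContMDiffAt 𝓘(ℂ, E × E) 𝓘(ℂ, E) ω (fun q : E × E ↦ (chartAt E (0 : G)).symm q.1) p :=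
    ((contMDiffOn_chart_symm (x := (0 : G))).contMDiffAt
      ((chartAt E (0 : G)).open_target.mem_nhds h1)).comp p contDiffAt_fst.contMDiffAt
  have hs2 : ContMDiffAt 𝓘(ℂ, E × E) 𝓘(ℂ, E) ω (fun q : E × E ↦ (chartAt E (0 : G)).symm q.2) p :=
    ((contMDiffOn_chart_symm (x := (0 : G))).contMDiffAt
      ((chartAt E (0 : G)).open_target.mem_nhds h2)).comp p contDiffAt_snd.contMDiffAt
  have hψ : ContMDiffAt 𝓘(ℂ, E) 𝓘(ℂ, E) ω (chartAt E (0 : G))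
      ((chartAt E (0 : G)).symm p.1 + (chartAt E (0 : G)).symm p.2) :=
    (contMDiffOn_chart (x := (0 : G))).contMDiffAt ((chartAt E (0 : G)).open_source.mem_nhds h12)
  exact (hψ.comp p (hs1.add hs2)).contDiffAt

/-- **The chart law at the identity of a commutative complex Lie group is a commutative
holomorphic local group law** at `c = ψ 0` (`ψ` the preferred chart at `0`).
[cite: Bourbaki2006LieGroups23, Ch. III §1 no. 10] -/
theorem isCommHolomorphicLocalGroupLaw_chartAt :
    IsCommHolomorphicLocalGroupLaw (fun a b : E ↦ chartAt E (0 : G)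
      ((chartAt E (0 : G)).symm a + (chartAt E (0 : G)).symm b)) (chartAt E (0 : G) 0) := by
  haveI : IsTopologicalAddGroup G := topologicalAddGroup_of_lieAddGroup 𝓘(ℂ, E) ω
  have h0 : (chartAt E (0 : G)).symm (chartAt E (0 : G) 0) = 0 :=
    (chartAt E (0 : G)).left_inv (mem_chart_source E (0 : G))
  have htgt : ∀ᶠ a in 𝓝 (chartAt E (0 : G) 0), a ∈ (chartAt E (0 : G)).target :=
    (chartAt E (0 : G)).open_target.mem_nhds (mem_chart_target E 0)
  have hsymm : ContinuousAt (chartAt E (0 : G)).symm (chartAt E (0 : G) 0) :=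
    (chartAt E (0 : G)).continuousAt_symm (mem_chart_target E 0)
  have hsrc : (chartAt E (0 : G)).source ∈ 𝓝 ((chartAt E (0 : G)).symm (chartAt E (0 : G) 0) +
      (chartAt E (0 : G)).symm (chartAt E (0 : G) 0)) := by
    rw [h0, add_zero]
    exact (chartAt E (0 : G)).open_source.mem_nhds (mem_chart_source E (0 : G))
  refine ⟨?_, ?_, ?_, ?_⟩
  · refine contDiffAt_chartLaw _ (mem_chart_target E 0) (mem_chart_target E 0) ?_
    rw [h0, add_zero]
    exact mem_chart_source E (0 : G)
  · filter_upwards [htgt] with a ha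
    simp only [h0, add_zero]
    exact (chartAt E (0 : G)).right_inv ha
  · -- associativity: both inner sums stay in the chart source near `(c, c, c)`
    have t1 : Tendsto (fun p : E × E × E ↦ p.1) (𝓝 (chartAt E (0 : G) 0, chartAt E (0 : G) 0,
        chartAt E (0 : G) 0)) (𝓝 (chartAt E (0 : G) 0)) := continuousAt_fst
    have t2 : Tendsto (fun p : E × E × E ↦ p.2.1) (𝓝 (chartAt E (0 : G) 0, chartAt E (0 : G) 0,
        chartAt E (0 : G) 0)) (𝓝 (chartAt E (0 : G) 0)) := continuousAt_fst.comp continuousAt_snd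
    have t3 : Tendsto (fun p : E × E × E ↦ p.2.2) (𝓝 (chartAt E (0 : G) 0, chartAt E (0 : G) 0,
        chartAt E (0 : G) 0)) (𝓝 (chartAt E (0 : G) 0)) := continuousAt_snd.comp continuousAt_snd
    have hc1 : Tendsto (fun p : E × E × E ↦
        (chartAt E (0 : G)).symm p.1 + (chartAt E (0 : G)).symm p.2.1) (𝓝 (chartAt E (0 : G) 0,
          chartAt E (0 : G) 0, chartAt E (0 : G) 0)) (𝓝 ((chartAt E (0 : G)).symm
          (chartAt E (0 : G) 0) + (chartAt E (0 : G)).symm (chartAt E (0 : G) 0))) :=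
      (hsymm.tendsto.comp t1).add (hsymm.tendsto.comp t2)
    have hc2 : Tendsto (fun p : E × E × E ↦
        (chartAt E (0 : G)).symm p.2.1 + (chartAt E (0 : G)).symm p.2.2) (𝓝 (chartAt E (0 : G) 0,
          chartAt E (0 : G) 0, chartAt E (0 : G) 0)) (𝓝 ((chartAt E (0 : G)).symm
          (chartAt E (0 : G) 0) + (chartAt E (0 : G)).symm (chartAt E (0 : G) 0))) :=
      (hsymm.tendsto.comp t2).add (hsymm.tendsto.comp t3)
    filter_upwards [hc1.eventually_mem hsrc, hc2.eventually_mem hsrc] with p hp1 hp2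
    simp only [(chartAt E (0 : G)).left_inv hp1, (chartAt E (0 : G)).left_inv hp2, add_assoc]
  · exact Eventually.of_forall fun p ↦ by simp only [add_comm]

/-! ### The local exponential chart -/

/-- **The local exponential chart** of a commutative complex Lie group: a partial homeomorphism
`f` from the ball `ball 0 ρ ⊆ E` onto a neighbourhood of `0 ∈ G`, holomorphic with holomorphic
inverse, `f 0 = 0`, and additive on the ball. It is `ψ⁻¹ ∘ L⁻¹` for the preferred chart `ψ` at
`0` and the local logarithm `L` of the chart law (`IsCommHolomorphicLocalGroupLaw.exists_localLog`,
canonical coordinates; Chevalley, Ch. IV §VIII), `L⁻¹` from the inverse function theorem — the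
germ at `0` of the exponential map (Mumford, *Abelian Varieties*, §1; Lange, Lemma 1.1.3 (c)).
[cite: MumfordAV1970, §1] -/
theorem exists_localExpChart [FiniteDimensional ℂ E] :
    ∃ (f : OpenPartialHomeomorph E G) (ρ : ℝ), 0 < ρ ∧ f.source = ball 0 ρ ∧ f 0 = 0 ∧
      ContMDiffOn 𝓘(ℂ, E) 𝓘(ℂ, E) ω f f.source ∧
      ContMDiffOn 𝓘(ℂ, E) 𝓘(ℂ, E) ω f.symm f.target ∧
      ∀ a b : E, ‖a‖ < ρ → ‖b‖ < ρ → f (a + b) = f a + f b := by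
  haveI : IsTopologicalAddGroup G := topologicalAddGroup_of_lieAddGroup 𝓘(ℂ, E) ω
  haveI : CompleteSpace E := FiniteDimensional.complete ℂ E
  have h := isCommHolomorphicLocalGroupLaw_chartAt (E := E) (G := G)
  obtain ⟨L, hL0, hLω, hLid, hLmc, hLadd⟩ := h.exists_localLog
  -- notation-free abbreviations
  have hψ0 : (chartAt E (0 : G)).symm (chartAt E (0 : G) 0) = 0 :=
    (chartAt E (0 : G)).left_inv (mem_chart_source E (0 : G))
  have hLid' : HasFDerivAt L ((ContinuousLinearEquiv.refl ℂ E : E ≃L[ℂ] E) : E →L[ℂ] E)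
      (chartAt E (0 : G) 0) := by
    rw [ContinuousLinearEquiv.coe_refl]; exact hLid
  set Λ := hLω.toOpenPartialHomeomorph L hLid' (by simp) with hΛ
  have hΛL : (Λ : E → E) = L := rfl
  have hcΛ : chartAt E (0 : G) 0 ∈ Λ.source := hLω.mem_toOpenPartialHomeomorph_source hLid' _
  have h0Λ : (0 : E) ∈ Λ.target := by
    rw [← hL0]; exact hLω.image_mem_toOpenPartialHomeomorph_target hLid' _
  have hΛ0 : Λ.symm 0 = chartAt E (0 : G) 0 := by
    rw [← hL0]; exact Λ.left_inv hcΛ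
  -- invertibility of the Maurer–Cartan form near `c`
  have hinv : ∀ᶠ y in 𝓝 (chartAt E (0 : G) 0),
      (fderiv ℂ (fun b ↦ chartAt E (0 : G) ((chartAt E (0 : G)).symm y +
        (chartAt E (0 : G)).symm b)) (chartAt E (0 : G) 0)).inverse.IsInvertible := by
    have hc := h.eventually_contDiffAt_mc.self_of_nhds.continuousAt
    have hn := ContinuousLinearEquiv.nhds (ContinuousLinearEquiv.refl ℂ E)
    rw [ContinuousLinearEquiv.coe_refl, ← h.mc_self] at hn
    filter_upwards [hc.preimage_mem_nhds hn] with y hy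
    obtain ⟨e, he⟩ := hy
    exact ⟨e, he⟩
  -- `Λ.symm` is analytic near `0`
  have hΛsymm : ContinuousAt Λ.symm 0 := Λ.continuousAt_symm h0Λ
  have hgood : ∀ᶠ v in 𝓝 (0 : E), v ∈ Λ.target ∧ Λ.symm v ∈ (chartAt E (0 : G)).target ∧
      ContDiffAt ℂ ω Λ.symm v ∧ ContDiffAt ℂ ω L (Λ.symm v) := by
    have hT : Tendsto Λ.symm (𝓝 0) (𝓝 (chartAt E (0 : G) 0)) := by
      simpa [ContinuousAt, hΛ0] using hΛsymm
    filter_upwards [Λ.open_target.mem_nhds h0Λ,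
      hT.eventually ((chartAt E (0 : G)).open_target.mem_nhds (mem_chart_target E 0)),
      hT.eventually (hLω.eventually (by simp)), hT.eventually hLmc, hT.eventually hinv]
      with v hv hvt hvω hvd hvi
    obtain ⟨e, he⟩ := hvi
    refine ⟨hv, hvt, ?_, hvω⟩
    exact Λ.contDiffAt_symm hv (by rw [hΛL, he]; exact hvd) hvω
  -- additivity near `(0, 0)`
  have hadd : ∀ᶠ q : E × E in 𝓝 (0, 0), q.1 ∈ Λ.target ∧ q.2 ∈ Λ.target ∧
      (chartAt E (0 : G)).symm (Λ.symm (q.1 + q.2)) =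
        (chartAt E (0 : G)).symm (Λ.symm q.1) + (chartAt E (0 : G)).symm (Λ.symm q.2) := by
    have hT : Tendsto (fun q : E × E ↦ (Λ.symm q.1, Λ.symm q.2)) (𝓝 (0, 0))
        (𝓝 (chartAt E (0 : G) 0, chartAt E (0 : G) 0)) := by
      have h1 : Tendsto Λ.symm (𝓝 0) (𝓝 (chartAt E (0 : G) 0)) := by
        simpa [ContinuousAt, hΛ0] using hΛsymm
      have t1 : Tendsto (fun q : E × E ↦ q.1) (𝓝 (0, 0)) (𝓝 0) := continuousAt_fst
      have t2 : Tendsto (fun q : E × E ↦ q.2) (𝓝 (0, 0)) (𝓝 0) := continuousAt_snd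
      exact (h1.comp t1).prodMk_nhds (h1.comp t2)
    have hsymmc : ContinuousAt (chartAt E (0 : G)).symm (chartAt E (0 : G) 0) :=
      (chartAt E (0 : G)).continuousAt_symm (mem_chart_target E 0)
    have t1' : Tendsto (fun p : E × E ↦ p.1) (𝓝 (chartAt E (0 : G) 0, chartAt E (0 : G) 0))
        (𝓝 (chartAt E (0 : G) 0)) := continuousAt_fst
    have t2' : Tendsto (fun p : E × E ↦ p.2) (𝓝 (chartAt E (0 : G) 0, chartAt E (0 : G) 0))
        (𝓝 (chartAt E (0 : G) 0)) := continuousAt_snd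
    have hsum : Tendsto (fun p : E × E ↦ (chartAt E (0 : G)).symm p.1 +
        (chartAt E (0 : G)).symm p.2) (𝓝 (chartAt E (0 : G) 0, chartAt E (0 : G) 0))
        (𝓝 ((chartAt E (0 : G)).symm (chartAt E (0 : G) 0) +
          (chartAt E (0 : G)).symm (chartAt E (0 : G) 0))) :=
      (hsymmc.tendsto.comp t1').add (hsymmc.tendsto.comp t2')
    have hsrc : (chartAt E (0 : G)).source ∈ 𝓝 ((chartAt E (0 : G)).symm (chartAt E (0 : G) 0)
        + (chartAt E (0 : G)).symm (chartAt E (0 : G) 0)) := by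
      rw [hψ0, add_zero]
      exact (chartAt E (0 : G)).open_source.mem_nhds (mem_chart_source E (0 : G))
    have hnear : ∀ᶠ p : E × E in 𝓝 (chartAt E (0 : G) 0, chartAt E (0 : G) 0),
        L (chartAt E (0 : G) ((chartAt E (0 : G)).symm p.1 + (chartAt E (0 : G)).symm p.2)) =
          L p.1 + L p.2 ∧
        chartAt E (0 : G) ((chartAt E (0 : G)).symm p.1 + (chartAt E (0 : G)).symm p.2) ∈
          Λ.source ∧
        (chartAt E (0 : G)).symm p.1 + (chartAt E (0 : G)).symm p.2 ∈
          (chartAt E (0 : G)).source := by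
      filter_upwards [hLadd, h.tendsto_nhds.eventually_mem (Λ.open_source.mem_nhds hcΛ),
        hsum.eventually_mem hsrc] with p h1 h2 h3
      exact ⟨h1, h2, h3⟩
    have t1 : Tendsto (fun q : E × E ↦ q.1) (𝓝 (0, 0)) (𝓝 0) := continuousAt_fst
    have t2 : Tendsto (fun q : E × E ↦ q.2) (𝓝 (0, 0)) (𝓝 0) := continuousAt_snd
    filter_upwards [hT.eventually hnear, t1.eventually (Λ.open_target.mem_nhds h0Λ),
      t2.eventually (Λ.open_target.mem_nhds h0Λ)] with q hq hq1 hq2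
    obtain ⟨hL, hS, hψS⟩ := hq
    have e1 : L (Λ.symm q.1) = q.1 := by rw [← hΛL]; exact Λ.right_inv hq1
    have e2 : L (Λ.symm q.2) = q.2 := by rw [← hΛL]; exact Λ.right_inv hq2
    rw [e1, e2] at hL
    refine ⟨hq1, hq2, ?_⟩
    have e3 : Λ.symm (q.1 + q.2) = chartAt E (0 : G) ((chartAt E (0 : G)).symm (Λ.symm q.1) +
        (chartAt E (0 : G)).symm (Λ.symm q.2)) := by
      rw [← hL, ← hΛL]; exact Λ.left_inv hS
    rw [e3, (chartAt E (0 : G)).left_inv hψS]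
  -- choose a radius
  obtain ⟨ρ₁, hρ₁, hball₁⟩ := Metric.eventually_nhds_iff_ball.1 hgood
  obtain ⟨ρ₂, hρ₂, hball₂⟩ := Metric.eventually_nhds_iff_ball.1 hadd
  set ρ := min ρ₁ ρ₂ with hρdef
  have hρ : 0 < ρ := lt_min hρ₁ hρ₂
  have hgood' : ∀ v ∈ ball (0 : E) ρ, v ∈ Λ.target ∧ Λ.symm v ∈ (chartAt E (0 : G)).target ∧
      ContDiffAt ℂ ω Λ.symm v ∧ ContDiffAt ℂ ω L (Λ.symm v) :=
    fun v hv ↦ hball₁ v (ball_subset_ball (min_le_left _ _) hv)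
  have hadd' : ∀ a b : E, ‖a‖ < ρ → ‖b‖ < ρ →
      (chartAt E (0 : G)).symm (Λ.symm (a + b)) =
        (chartAt E (0 : G)).symm (Λ.symm a) + (chartAt E (0 : G)).symm (Λ.symm b) := by
    intro a b ha hb
    have hab : (a, b) ∈ ball ((0 : E), (0 : E)) ρ₂ := by
      rw [← ball_prod_same]
      exact ⟨mem_ball_zero_iff.2 (hb.trans_le' le_rfl |> fun _ ↦ ha.trans_le (min_le_right _ _)),
        mem_ball_zero_iff.2 (hb.trans_le (min_le_right _ _))⟩
    exact (hball₂ (a, b) hab).2.2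
  -- the chart
  set f₀ : OpenPartialHomeomorph E G := Λ.symm.trans (chartAt E (0 : G)).symm with hf₀
  have hsub : ball (0 : E) ρ ⊆ f₀.source := by
    intro v hv
    rw [hf₀, OpenPartialHomeomorph.trans_source, OpenPartialHomeomorph.symm_source]
    exact ⟨(hgood' v hv).1, (hgood' v hv).2.1⟩
  refine ⟨f₀.restrOpen (ball 0 ρ) isOpen_ball, ρ, hρ, ?_, ?_, ?_, ?_, ?_⟩
  · rw [OpenPartialHomeomorph.restrOpen_source, inter_eq_right.2 hsub]
  · show (chartAt E (0 : G)).symm (Λ.symm 0) = 0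
    rw [hΛ0, hψ0]
  · rw [OpenPartialHomeomorph.restrOpen_source, inter_eq_right.2 hsub]
    intro v hv
    have hv' := hgood' v hv
    have h1 : ContMDiffAt 𝓘(ℂ, E) 𝓘(ℂ, E) ω (chartAt E (0 : G)).symm (Λ.symm v) :=
      (contMDiffOn_chart_symm (x := (0 : G))).contMDiffAt
        ((chartAt E (0 : G)).open_target.mem_nhds hv'.2.1)
    exact (h1.comp v hv'.2.2.1.contMDiffAt).contMDiffWithinAt
  · intro g hg
    have hg' : g ∈ f₀.target ∧ f₀.symm g ∈ ball (0 : E) ρ := by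
      simpa [OpenPartialHomeomorph.restrOpen_toPartialEquiv] using hg
    have hgT : g ∈ (chartAt E (0 : G)).source ∧ chartAt E (0 : G) g ∈ Λ.source := by
      have := hg'.1
      rw [hf₀, OpenPartialHomeomorph.trans_target] at this
      simpa using this
    have hv' := hgood' _ hg'.2
    have e1 : Λ.symm (f₀.symm g) = chartAt E (0 : G) g := by
      show Λ.symm (Λ (chartAt E (0 : G) g)) = chartAt E (0 : G) g
      exact Λ.left_inv hgT.2
    rw [e1] at hv'
    have h1 : ContMDiffAt 𝓘(ℂ, E) 𝓘(ℂ, E) ω (chartAt E (0 : G)) g :=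
      (contMDiffOn_chart (x := (0 : G))).contMDiffAt
        ((chartAt E (0 : G)).open_source.mem_nhds hgT.1)
    exact (hv'.2.2.2.contMDiffAt.comp g h1).contMDiffWithinAt
  · intro a b ha hb
    exact hadd' a b ha hb

end Literature.Geometry.Kaehler
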